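import Summits.Ventures.LatticeQCDFlow.Scaling.HubChainTransitionLaw

/-!
HONEST FRAMING: exact (Metropolis-corrected) sampling algorithms for lattice gauge theory; figures
of merit are autocorrelation/cost numbers at stated couplings and volumes; no continuum-physics
claim.

# HubChainResolvent — THE SWAP PHASE SOLVED EXACTLY, III: THE `σ`-RESOLVENT OF THE HUB CHAIN (CHAPTER W'S END-HUB LAW) IN CLOSED FORM, `u(i,j) = ρ_j·(1/R + Σ_k γ_k f_k(i)f_k(j)/(ρ_kR_kR_{k+1}))`
# WITH `γ_k = (1−σ)/(1−σβ_k)`, ITS UNIQUENESS, AND ITS SMITH–TIERNEY FORM `u(i,j) = ρ_j·𝒯(deeper of i,j) + γ_i·δ_{ij}` WITH `𝒯(j) = (1−γ_j)/R + Σ_{k>j}(1/R_k − 1/R_{k+1})(γ_k − γ_j) ≥ 0`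
# NON-INCREASING IN THE DEPTH RANK (lean-2 GEN-39, ours)

Venture-side (OURS).  Cell `lqcd-flow` (pub-lqcd), unit `pub-lqcd-lean-2-g39`, 2026-08-30.  Chapter Y (the swap phase solved exactly), file 3.  Setting and hypothesis-equations of
files 1–2.  The end-hub law of a refresh cycle at swap odds `σ` is the geometric resolvent `u = (1−σ)Σ_nσⁿPⁿ` of the hub chain (chapter W, `ResolventLaw`: `u = (1−σ)δ + σuP`); by the
eigenbasis of file 1 each mode `k` is resummed to `γ_k = (1−σ)/(1−σβ_k)`:

* `hubChain_resolvent_solves`: the closed form satisfies the resolvent equation `u(i,j) = (1−σ)δ_{ij} + σΣ_l u(i,l)P(l,j)` on `range m`;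
* `hubChain_resolvent_unique`: the resolvent equation has at most one solution on `range m` (reversibility turns the column equation into a row equation; maximum principle);
* **`hubChain_resolvent_eq`**: hence any solution IS the closed form;
* **`hubChain_resolvent_offdiag`** ∕ **`hubChain_resolvent_diag`**: `u(i,j) = ρ_j·𝒯(max(i,j))` for `i ≠ j` and `u(j,j) = ρ_j𝒯(j) + γ_j`, `𝒯(j) = (1−γ_j)/R_m + Σ_{j<k<m}(1/R_k − 1/R_{k+1})(γ_k − γ_j)`;
* `hubChain_gamma_mono` (`γ` non-decreasing in the rank, `0 < γ_k ≤ 1`), `hubChain_T_res_nonneg`, **`hubChain_T_res_anti`** (`𝒯` non-increasing in the rank: per unit weight,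
  the discounted hub occupation of a deeper target is smaller).

Reading (no numerics implied): the end-hub law `u_z(c)` of chapters V–W for the labelled star is `ρ_c·𝒯(max(rank z, rank c))` off the start — explicit in the depths; e.g. the gain
`x̃(★)` of MEMO-gen37's criterion.  Literature grade (cell rule): OWN, elementary; nothing cited; no new bib keys.
-/

open Finset

namespace Summit.Ventures.LatticeQCDFlow.Scaling

section HubChainRes
variable {m : ℕ} {ρ R β γ : ℕ → ℝ} {c σ : ℝ} {P f u : ℕ → ℕ → ℝ} {Tr : ℕ → ℝ}

/-- `0 < γ_k ≤ 1` and `1 − σβ_k > 0` for `σ ∈ [0,1)`, `c ≥ 0` (since `β_k ≤ 1 − c ≤ 1` and `β_k ≥ 1 − cm > −∞`). [ours] -/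
theorem hubChain_gamma_pos (hρ : ∀ i, 0 < ρ i) (hmono : Monotone ρ) (hR : ∀ k, R k = ∑ i ∈ range k, ρ i)
    (hβ : ∀ k, β k = 1 - c * (((m - k : ℕ) : ℝ) + R k / ρ k)) (hc : 0 ≤ c) (hσ0 : 0 ≤ σ) (hσ1 : σ < 1)
    (hγ : ∀ k, γ k = (1 - σ) / (1 - σ * β k)) {k : ℕ} (hk : k < m) : 0 < 1 - σ * β k ∧ 0 < γ k ∧ γ k ≤ 1 := by
  have hb := hubChain_beta_le hρ hmono hR hβ hc hk
  have h1 : 0 < 1 - σ * β k := by nlinarith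
  refine ⟨h1, by rw [hγ]; exact div_pos (by linarith) h1, ?_⟩
  rw [hγ, div_le_one h1]; nlinarith

/-- **`γ` is non-decreasing in the depth rank** (`β` is, and `t ↦ (1−σ)/(1−σt)` is increasing on `t < 1/σ`). [ours] -/
theorem hubChain_gamma_mono (hρ : ∀ i, 0 < ρ i) (hmono : Monotone ρ) (hR : ∀ k, R k = ∑ i ∈ range k, ρ i)
    (hβ : ∀ k, β k = 1 - c * (((m - k : ℕ) : ℝ) + R k / ρ k)) (hc : 0 ≤ c) (hσ0 : 0 ≤ σ) (hσ1 : σ < 1)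
    (hγ : ∀ k, γ k = (1 - σ) / (1 - σ * β k)) {k l : ℕ} (hkl : k ≤ l) (hl : l < m) : γ k ≤ γ l := by
  have hk : k < m := lt_of_le_of_lt hkl hl
  have hbk := hubChain_gamma_pos hρ hmono hR hβ hc hσ0 hσ1 hγ hk
  have hbl := hubChain_gamma_pos hρ hmono hR hβ hc hσ0 hσ1 hγ hl
  have hmn := hubChain_beta_mono hρ hmono hR hβ hc hkl hl
  rw [hγ k, hγ l, div_le_div_iff₀ hbk.1 hbl.1]
  have h1 : σ * β k ≤ σ * β l := mul_le_mul_of_nonneg_left hmn hσ0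
  exact mul_le_mul_of_nonneg_left (by linarith) (by linarith)

/-- **The closed form solves the resolvent equation** `u(i,j) = (1−σ)δ_{ij} + σΣ_{l<m} u(i,l)P(l,j)` (for `i, j < m`). [ours] -/
theorem hubChain_resolvent_solves (hρ : ∀ i, 0 < ρ i) (hmono : Monotone ρ) (hR : ∀ k, R k = ∑ i ∈ range k, ρ i)
    (hPoff : ∀ i j, i ≠ j → P i j = c * min 1 (ρ j / ρ i)) (hPdiag : ∀ i, P i i = 1 - ∑ j ∈ (range m).erase i, P i j)
    (hf : ∀ k i, f k i = if i < k then ρ k else if i = k then -R k else 0)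
    (hβ : ∀ k, β k = 1 - c * (((m - k : ℕ) : ℝ) + R k / ρ k)) (hc : 0 ≤ c) (hσ0 : 0 ≤ σ) (hσ1 : σ < 1)
    (hγ : ∀ k, γ k = (1 - σ) / (1 - σ * β k)) {i j : ℕ} (hi : i < m) (hj : j < m) :
    ρ j * (1 / R m + ∑ k ∈ range m, γ k * (f k i * f k j) / (ρ k * R k * R (k + 1)))
      = (1 - σ) * (if i = j then 1 else 0) + σ * ∑ l ∈ range m, ρ l * (1 / R m + ∑ k ∈ range m, γ k * (f k i * f k l) / (ρ k * R k * R (k + 1))) * P l j := by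
  -- push `P` through: `Σ_l ρ_l(…)P(l,j) = ρ_j(1/R + Σ_k γ_kβ_k f_k(i)f_k(j)/N_k)` by stationarity and the left eigen-equation
  have hpush : ∑ l ∈ range m, ρ l * (1 / R m + ∑ k ∈ range m, γ k * (f k i * f k l) / (ρ k * R k * R (k + 1))) * P l j
      = ρ j * (1 / R m + ∑ k ∈ range m, γ k * β k * (f k i * f k j) / (ρ k * R k * R (k + 1))) := by
    calc ∑ l ∈ range m, ρ l * (1 / R m + ∑ k ∈ range m, γ k * (f k i * f k l) / (ρ k * R k * R (k + 1))) * P l j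
        = ∑ l ∈ range m, ((1 / R m) * (ρ l * P l j) + ∑ k ∈ range m, (γ k * f k i / (ρ k * R k * R (k + 1))) * (ρ l * f k l * P l j)) := by
          refine sum_congr rfl fun l _ => ?_
          rw [mul_add, add_mul, mul_sum, sum_mul]
          congr 1
          · ring
          · exact sum_congr rfl fun k _ => by ring
      _ = (1 / R m) * ρ j + ∑ k ∈ range m, (γ k * f k i / (ρ k * R k * R (k + 1))) * (β k * ρ j * f k j) := by
          rw [sum_add_distrib, ← mul_sum, hubChain_rho_stationary hρ hPoff hPdiag hj, sum_comm]
          congr 1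
          exact sum_congr rfl fun k hk => by rw [← mul_sum, hubChain_eigen_left hρ hmono hR hPoff hPdiag hf hβ (mem_range.mp hk) hj]
      _ = ρ j * (1 / R m + ∑ k ∈ range m, γ k * β k * (f k i * f k j) / (ρ k * R k * R (k + 1))) := by
          rw [mul_add, mul_sum]; congr 1; · ring
          · exact sum_congr rfl fun k _ => by ring
  rw [hpush, ← hubChain_complete hρ hR hf hi hj]
  -- compare mode by mode: `γ_k = (1−σ)·1 + σγ_kβ_k`
  have e : ∑ k ∈ range m, γ k * (f k i * f k j) / (ρ k * R k * R (k + 1))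
      = (1 - σ) * ∑ k ∈ range m, f k i * f k j / (ρ k * R k * R (k + 1)) + σ * ∑ k ∈ range m, γ k * β k * (f k i * f k j) / (ρ k * R k * R (k + 1)) := by
    rw [mul_sum, mul_sum, ← sum_add_distrib]
    refine sum_congr rfl fun k hk => ?_
    have h1 := (hubChain_gamma_pos hρ hmono hR hβ hc hσ0 hσ1 hγ (mem_range.mp hk)).1
    have hγk : γ k = (1 - σ) + σ * (γ k * β k) := by
      rw [hγ]; field_simp; ring
    calc γ k * (f k i * f k j) / (ρ k * R k * R (k + 1)) = ((1 - σ) + σ * (γ k * β k)) * (f k i * f k j) / (ρ k * R k * R (k + 1)) := by rw [← hγk]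
      _ = (1 - σ) * (f k i * f k j / (ρ k * R k * R (k + 1))) + σ * (γ k * β k * (f k i * f k j) / (ρ k * R k * R (k + 1))) := by ring
  rw [e]; ring

/-- **Uniqueness for the resolvent equation on `range m`:** two solutions of `v(j) = g(j) + σΣ_{l<m} v(l)P(l,j)` (`j < m`) agree on `range m` (`σ ∈ [0,1)`, `c(m−1) ≤ 1` so that `P ≥ 0`).
Reversibility converts the column equation for `v` into a row equation for `v/ρ`, to which the maximum principle applies. [ours] -/
theorem hubChain_resolvent_unique (hρ : ∀ i, 0 < ρ i) (hmono : Monotone ρ) (hR : ∀ k, R k = ∑ i ∈ range k, ρ i)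
    (hPoff : ∀ i j, i ≠ j → P i j = c * min 1 (ρ j / ρ i)) (hPdiag : ∀ i, P i i = 1 - ∑ j ∈ (range m).erase i, P i j)
    (hβ : ∀ k, β k = 1 - c * (((m - k : ℕ) : ℝ) + R k / ρ k)) (hc : 0 ≤ c) (hcm : c * m ≤ 1 + c) (hσ0 : 0 ≤ σ) (hσ1 : σ < 1)
    {g v w : ℕ → ℝ} (hv : ∀ j, j < m → v j = g j + σ * ∑ l ∈ range m, v l * P l j) (hw : ∀ j, j < m → w j = g j + σ * ∑ l ∈ range m, w l * P l j) :
    ∀ j, j < m → v j = w j := by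
  classical
  -- `h := (v − w)/ρ` satisfies the ROW equation `h(j) = σΣ_l P(j,l)h(l)` on `range m`
  have hP0 : ∀ i j, i < m → j < m → 0 ≤ P i j := by
    intro i j hi hj
    by_cases hij : i = j
    · subst hij; exact hubChain_diag_nonneg hρ hmono hR hPoff hPdiag hβ hc hcm hi
    · rw [hPoff i j hij]; exact mul_nonneg hc (le_min zero_le_one (div_nonneg (hρ j).le (hρ i).le))
  set h : ℕ → ℝ := fun j => (v j - w j) / ρ j with hh
  have hrow : ∀ j, j < m → h j = σ * ∑ l ∈ range m, P j l * h l := by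
    intro j hj
    have e2 : σ * ∑ l ∈ range m, (v l - w l) * P l j = σ * ∑ l ∈ range m, v l * P l j - σ * ∑ l ∈ range m, w l * P l j := by
      rw [← mul_sub, ← sum_sub_distrib]; congr 1; exact sum_congr rfl fun l _ => by ring
    have e : v j - w j = σ * ∑ l ∈ range m, (v l - w l) * P l j := by rw [e2, hv j hj, hw j hj]; ring
    simp only [hh]
    rw [e, mul_div_assoc, sum_div]
    congr 1
    refine sum_congr rfl fun l _ => ?_
    have hrev := hubChain_reversible hρ hPoff l j
    have hρj := (hρ j).ne'; have hρl := (hρ l).ne'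
    field_simp
    linear_combination (v l - w l) * hrev
  -- maximum principle on `range m`
  by_cases hm : m = 0
  · intro j hj; omega
  obtain ⟨j₀, hj₀, hmax⟩ := exists_max_image (range m) (fun j => |h j|) ⟨0, mem_range.mpr (Nat.pos_of_ne_zero hm)⟩
  have hM : |h j₀| ≤ σ * |h j₀| := by
    calc |h j₀| = |σ * ∑ l ∈ range m, P j₀ l * h l| := by rw [← hrow j₀ (mem_range.mp hj₀)]
      _ ≤ σ * ∑ l ∈ range m, P j₀ l * |h l| := by
          rw [abs_mul, abs_of_nonneg hσ0]
          refine mul_le_mul_of_nonneg_left ((abs_sum_le_sum_abs _ _).trans (le_of_eq (sum_congr rfl fun l hl => ?_))) hσ0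
          rw [abs_mul, abs_of_nonneg (hP0 j₀ l (mem_range.mp hj₀) (mem_range.mp hl))]
      _ ≤ σ * ∑ l ∈ range m, P j₀ l * |h j₀| :=
          mul_le_mul_of_nonneg_left (sum_le_sum fun l hl => mul_le_mul_of_nonneg_left (hmax l hl) (hP0 j₀ l (mem_range.mp hj₀) (mem_range.mp hl))) hσ0
      _ = σ * |h j₀| := by rw [← sum_mul, hubChain_rowsum hPdiag (mem_range.mp hj₀), one_mul]
  have h0 : |h j₀| = 0 := by nlinarith [abs_nonneg (h j₀)]
  intro j hj
  have hj' : |h j| ≤ 0 := h0 ▸ hmax j (mem_range.mpr hj)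
  have : h j = 0 := abs_eq_zero.mp (le_antisymm hj' (abs_nonneg _))
  simp only [hh] at this
  rcases div_eq_zero_iff.mp this with h1 | h1
  · linarith
  · exact absurd h1 (hρ j).ne'

/-- **THE END-HUB LAW IN CLOSED FORM:** a solution of the resolvent equation `u(i,j) = (1−σ)δ_{ij} + σΣ_{l<m}u(i,l)P(l,j)` (`j < m`) is
`u(i,j) = ρ_j·(1/R_m + Σ_{k<m} γ_k f_k(i)f_k(j)/(ρ_kR_kR_{k+1}))`, `γ_k = (1−σ)/(1−σβ_k)`, for `i, j < m`. [ours] -/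
theorem hubChain_resolvent_eq (hρ : ∀ i, 0 < ρ i) (hmono : Monotone ρ) (hR : ∀ k, R k = ∑ i ∈ range k, ρ i)
    (hPoff : ∀ i j, i ≠ j → P i j = c * min 1 (ρ j / ρ i)) (hPdiag : ∀ i, P i i = 1 - ∑ j ∈ (range m).erase i, P i j)
    (hf : ∀ k i, f k i = if i < k then ρ k else if i = k then -R k else 0)
    (hβ : ∀ k, β k = 1 - c * (((m - k : ℕ) : ℝ) + R k / ρ k)) (hc : 0 ≤ c) (hcm : c * m ≤ 1 + c) (hσ0 : 0 ≤ σ) (hσ1 : σ < 1)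
    (hγ : ∀ k, γ k = (1 - σ) / (1 - σ * β k))
    (hu : ∀ i j, j < m → u i j = (1 - σ) * (if i = j then 1 else 0) + σ * ∑ l ∈ range m, u i l * P l j) {i j : ℕ} (hi : i < m) (hj : j < m) :
    u i j = ρ j * (1 / R m + ∑ k ∈ range m, γ k * (f k i * f k j) / (ρ k * R k * R (k + 1))) :=
  hubChain_resolvent_unique hρ hmono hR hPoff hPdiag hβ hc hcm hσ0 hσ1 (g := fun j => (1 - σ) * (if i = j then (1:ℝ) else 0))
    (v := fun j => u i j) (w := fun j => ρ j * (1 / R m + ∑ k ∈ range m, γ k * (f k i * f k j) / (ρ k * R k * R (k + 1))))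
    (fun j hj => hu i j hj) (fun _ hj => hubChain_resolvent_solves hρ hmono hR hPoff hPdiag hf hβ hc hσ0 hσ1 hγ hi hj) j hj

/-- **Smith–Tierney form of the resolvent, off the diagonal:** `u(i,j) = ρ_j·𝒯(max(i,j))` with `𝒯(j) = (1−γ_j)/R_m + Σ_{j<k<m}(1/R_k − 1/R_{k+1})(γ_k − γ_j)`. [ours] -/
theorem hubChain_resolvent_offdiag (hρ : ∀ i, 0 < ρ i) (hmono : Monotone ρ) (hR : ∀ k, R k = ∑ i ∈ range k, ρ i)
    (hPoff : ∀ i j, i ≠ j → P i j = c * min 1 (ρ j / ρ i)) (hPdiag : ∀ i, P i i = 1 - ∑ j ∈ (range m).erase i, P i j)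
    (hf : ∀ k i, f k i = if i < k then ρ k else if i = k then -R k else 0)
    (hβ : ∀ k, β k = 1 - c * (((m - k : ℕ) : ℝ) + R k / ρ k)) (hc : 0 ≤ c) (hcm : c * m ≤ 1 + c) (hσ0 : 0 ≤ σ) (hσ1 : σ < 1)
    (hγ : ∀ k, γ k = (1 - σ) / (1 - σ * β k))
    (hu : ∀ i j, j < m → u i j = (1 - σ) * (if i = j then 1 else 0) + σ * ∑ l ∈ range m, u i l * P l j)
    (hTr : ∀ j, Tr j = (1 - γ j) / R m + ∑ k ∈ Ico (j + 1) m, (1 / R k - 1 / R (k + 1)) * (γ k - γ j))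
    {i j : ℕ} (hi : i < m) (hj : j < m) (hij : i ≠ j) : u i j = ρ j * Tr (max i j) := by
  have hTexp : ∀ jj, jj < m → Tr jj = 1 / R m - γ jj / R (jj + 1) + ∑ k ∈ Ico (jj + 1) m, γ k * (1 / R k - 1 / R (k + 1)) := by
    intro jj hjj
    rw [hTr]
    have e : ∑ k ∈ Ico (jj + 1) m, (1 / R k - 1 / R (k + 1)) * (γ k - γ jj)
        = ∑ k ∈ Ico (jj + 1) m, γ k * (1 / R k - 1 / R (k + 1)) - γ jj * ∑ k ∈ Ico (jj + 1) m, (1 / R k - 1 / R (k + 1)) := by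
      rw [mul_sum, ← sum_sub_distrib]; exact sum_congr rfl fun k _ => by ring
    rw [e, hubChain_telescope hjj]
    ring
  rw [hubChain_resolvent_eq hρ hmono hR hPoff hPdiag hf hβ hc hcm hσ0 hσ1 hγ hu hi hj]
  rcases Nat.lt_or_gt_of_ne hij with hlt | hgt
  · rw [max_eq_right hlt.le, hubChain_mode_sum hρ hR hf γ hlt.le hj, hTexp j hj]
    have hRj1 : R (j + 1) = R j + ρ j := by rw [hR (j + 1), sum_range_succ, ← hR j]
    have hRj : 0 < R j := by rw [hR j]; exact sum_pos (fun i _ => hρ i) ⟨i, mem_range.mpr hlt⟩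
    rw [hf j i, if_pos hlt, hf j j, if_neg (lt_irrefl j), if_pos rfl, hRj1]
    have hρj := hρ j
    field_simp
    ring
  · rw [max_eq_left hgt.le]
    rw [show (∑ k ∈ range m, γ k * (f k i * f k j) / (ρ k * R k * R (k + 1))) = ∑ k ∈ range m, γ k * (f k j * f k i) / (ρ k * R k * R (k + 1)) from
      sum_congr rfl fun k _ => by rw [mul_comm (f k i)]]
    rw [hubChain_mode_sum hρ hR hf γ hgt.le hi, hTexp i hi]
    have hRi1 : R (i + 1) = R i + ρ i := by rw [hR (i + 1), sum_range_succ, ← hR i]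
    have hRi : 0 < R i := by rw [hR i]; exact sum_pos (fun i _ => hρ i) ⟨j, mem_range.mpr hgt⟩
    rw [hf i j, if_pos hgt, hf i i, if_neg (lt_irrefl i), if_pos rfl, hRi1]
    have hρi := hρ i
    field_simp
    ring

/-- **Smith–Tierney form of the resolvent, on the diagonal:** `u(j,j) = ρ_j𝒯(j) + γ_j` (the discounted self-term). [ours] -/
theorem hubChain_resolvent_diag (hρ : ∀ i, 0 < ρ i) (hmono : Monotone ρ) (hR : ∀ k, R k = ∑ i ∈ range k, ρ i)
    (hPoff : ∀ i j, i ≠ j → P i j = c * min 1 (ρ j / ρ i)) (hPdiag : ∀ i, P i i = 1 - ∑ j ∈ (range m).erase i, P i j)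
    (hf : ∀ k i, f k i = if i < k then ρ k else if i = k then -R k else 0)
    (hβ : ∀ k, β k = 1 - c * (((m - k : ℕ) : ℝ) + R k / ρ k)) (hc : 0 ≤ c) (hcm : c * m ≤ 1 + c) (hσ0 : 0 ≤ σ) (hσ1 : σ < 1)
    (hγ : ∀ k, γ k = (1 - σ) / (1 - σ * β k))
    (hu : ∀ i j, j < m → u i j = (1 - σ) * (if i = j then 1 else 0) + σ * ∑ l ∈ range m, u i l * P l j)
    (hTr : ∀ j, Tr j = (1 - γ j) / R m + ∑ k ∈ Ico (j + 1) m, (1 / R k - 1 / R (k + 1)) * (γ k - γ j))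
    {j : ℕ} (hj : j < m) : u j j = ρ j * Tr j + γ j := by
  rw [hubChain_resolvent_eq hρ hmono hR hPoff hPdiag hf hβ hc hcm hσ0 hσ1 hγ hu hj hj, hubChain_mode_sum hρ hR hf γ le_rfl hj, hTr]
  have e : ∑ k ∈ Ico (j + 1) m, (1 / R k - 1 / R (k + 1)) * (γ k - γ j)
      = ∑ k ∈ Ico (j + 1) m, γ k * (1 / R k - 1 / R (k + 1)) - γ j * ∑ k ∈ Ico (j + 1) m, (1 / R k - 1 / R (k + 1)) := by
    rw [mul_sum, ← sum_sub_distrib]; exact sum_congr rfl fun k _ => by ring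
  rw [e, hubChain_telescope hj]
  have hRj1 : R (j + 1) = R j + ρ j := by rw [hR (j + 1), sum_range_succ, ← hR j]
  have hR0 : 0 ≤ R j := by rw [hR j]; exact sum_nonneg fun i _ => (hρ i).le
  have hρj := hρ j
  have hRj1pos : 0 < R (j + 1) := by rw [hRj1]; linarith
  rw [hf j j, if_neg (lt_irrefl j), if_pos rfl, hRj1]
  by_cases hRj : R j = 0
  · rw [hRj]; simp; field_simp; ring
  · field_simp
    ring

/-- `𝒯(j) ≥ 0` for `j < m` (all terms are non-negative: `γ ≤ 1`, `γ` non-decreasing, `R` increasing). [ours] -/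
theorem hubChain_T_res_nonneg (hρ : ∀ i, 0 < ρ i) (hmono : Monotone ρ) (hR : ∀ k, R k = ∑ i ∈ range k, ρ i)
    (hβ : ∀ k, β k = 1 - c * (((m - k : ℕ) : ℝ) + R k / ρ k)) (hc : 0 ≤ c) (hσ0 : 0 ≤ σ) (hσ1 : σ < 1)
    (hγ : ∀ k, γ k = (1 - σ) / (1 - σ * β k))
    (hTr : ∀ j, Tr j = (1 - γ j) / R m + ∑ k ∈ Ico (j + 1) m, (1 / R k - 1 / R (k + 1)) * (γ k - γ j)) {j : ℕ} (hj : j < m) : 0 ≤ Tr j := by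
  rw [hTr]
  have hRm : 0 < R m := by rw [hR m]; exact sum_pos (fun i _ => hρ i) ⟨j, mem_range.mpr hj⟩
  have hgj := hubChain_gamma_pos hρ hmono hR hβ hc hσ0 hσ1 hγ hj
  refine add_nonneg (div_nonneg (by linarith [hgj.2.2]) hRm.le) (sum_nonneg fun k hk => ?_)
  have hk : j + 1 ≤ k ∧ k < m := by simpa using mem_Ico.mp hk
  have hRk : 0 < R k := by rw [hR k]; exact sum_pos (fun i _ => hρ i) ⟨0, mem_range.mpr (by omega)⟩
  have hRk1 : R k ≤ R (k + 1) := by rw [hR (k + 1), sum_range_succ, ← hR k]; linarith [hρ k]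
  refine mul_nonneg ?_ (by linarith [hubChain_gamma_mono hρ hmono hR hβ hc hσ0 hσ1 hγ (by omega : j ≤ k) hk.2])
  rw [sub_nonneg]; exact one_div_le_one_div_of_le hRk hRk1

/-- **`𝒯` is non-increasing in the depth rank:** `𝒯(j+1) ≤ 𝒯(j)` for `j + 1 < m`. [ours] -/
theorem hubChain_T_res_anti (hρ : ∀ i, 0 < ρ i) (hmono : Monotone ρ) (hR : ∀ k, R k = ∑ i ∈ range k, ρ i)
    (hβ : ∀ k, β k = 1 - c * (((m - k : ℕ) : ℝ) + R k / ρ k)) (hc : 0 ≤ c) (hσ0 : 0 ≤ σ) (hσ1 : σ < 1)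
    (hγ : ∀ k, γ k = (1 - σ) / (1 - σ * β k))
    (hTr : ∀ j, Tr j = (1 - γ j) / R m + ∑ k ∈ Ico (j + 1) m, (1 / R k - 1 / R (k + 1)) * (γ k - γ j)) {j : ℕ} (hj : j + 1 < m) : Tr (j + 1) ≤ Tr j := by
  rw [hTr j, hTr (j + 1), Finset.sum_eq_sum_Ico_succ_bot hj]
  have hRm : 0 < R m := by rw [hR m]; exact sum_pos (fun i _ => hρ i) ⟨j, mem_range.mpr (by omega)⟩
  have hg := hubChain_gamma_mono hρ hmono hR hβ hc hσ0 hσ1 hγ (Nat.le_succ j) hj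
  have hRk : 0 < R (j + 1) := by rw [hR (j + 1)]; exact sum_pos (fun i _ => hρ i) ⟨0, mem_range.mpr (by omega)⟩
  have hRk1 : R (j + 1) ≤ R (j + 1 + 1) := by rw [hR (j + 1 + 1), sum_range_succ, ← hR (j + 1)]; linarith [hρ (j + 1)]
  have hterm : 0 ≤ (1 / R (j + 1) - 1 / R (j + 1 + 1)) * (γ (j + 1) - γ j) :=
    mul_nonneg (by rw [sub_nonneg]; exact one_div_le_one_div_of_le hRk hRk1) (by linarith)
  have hrest : ∑ k ∈ Ico (j + 1 + 1) m, (1 / R k - 1 / R (k + 1)) * (γ k - γ (j + 1)) ≤ ∑ k ∈ Ico (j + 1 + 1) m, (1 / R k - 1 / R (k + 1)) * (γ k - γ j) := by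
    refine sum_le_sum fun k hk => ?_
    have hk' : j + 1 + 1 ≤ k ∧ k < m := by simpa using mem_Ico.mp hk
    have hRk' : 0 < R k := by rw [hR k]; exact sum_pos (fun i _ => hρ i) ⟨0, mem_range.mpr (by omega)⟩
    have hRk1' : R k ≤ R (k + 1) := by rw [hR (k + 1), sum_range_succ, ← hR k]; linarith [hρ k]
    exact mul_le_mul_of_nonneg_left (by linarith) (by rw [sub_nonneg]; exact one_div_le_one_div_of_le hRk' hRk1')
  have h1 : (1 - γ (j + 1)) / R m ≤ (1 - γ j) / R m := div_le_div_of_nonneg_right (by linarith) hRm.le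
  linarith

end HubChainRes

end Summit.Ventures.LatticeQCDFlow.Scaling
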